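import Summits.HodgeConjecture.HodgeConjecture.Theorems.Ring2AbelianAllAndreLerayIdempotentFromLiftsDegree
import Summits.HodgeConjecture.HodgeConjecture.Theorems.Ring2AbelianAllAndreFibreClassDivisorialNodes
import HarnessLib

/-!
# Ring 2 · sub-cell AbelianAll (ALL ABELIAN VARIETIES), André axis, part XXVIII-d — BY NAME: the column's predicate (N_p f)(t)
# `AlgebraicInvariantClassesAt` (part XIV-f) IS the idempotent package at `(t, 2p)`; below the middle it propagates to the
# complementary degree, so the algebraic fixed part of a pencil — and with it (β′_f) and all the Leray idempotents — is decided
# in the degrees `2p ≤ d`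

HONEST FRAMING (page 1, verbatim): **research route, not a corollary; conditional on HC_CM plus one named
minimal statement.** Cell line: research route conditional on HC_CM; not a corollary; Q11.4-sentence-2
already refuted in dim ≥ 3. Nothing in this file proves a case of the Hodge conjecture for an abelian variety; `HC_CM` does not occur in
this file; item `Theses.RankFourFaces.CMToAbelian` (stmt-16267) OPEN and not closed here. Seat `pub-hodge-ring2-ab-andre-2`, gen 20; brief (ii).

## Why this file

Parts XXVIII-a/c phrase their hypothesis (A) as `LinearMap.range j_t^* ≤ (Nᵖ 𝒳).map j_t^*`. The column already has a NAME for it: part XIV-f's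
per-pencil predicate **(N_p f)(t) `AlgebraicInvariantClassesAt hf t p`** ("every class of `j_t^* H^{2p}(𝒳)` is the restriction of an algebraic
class of `𝒳`"; point-free by `algebraicInvariantClassesAt_of_at`; `(N_0)`, `(N_d)` hold; `⋀_p (N_p) ⟹ (β′_f)` with the explicit cycles
`∑ Dᵢ × Aᵢ`, part XIV-e). This file restates part XXVIII by that name and adds the one structural fact that was missing:

* §1 `algebraicInvariantClassesAt_iff_range_le_map`, `algebraicInvariantClassesAt_iff_sup_ker_eq_top` (`(N_p f)(t) ⟺ Nᵖ(𝒳) ⊔ ker j_t^* = ⊤`),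
  `algebraicInvariantClassesAt_iff_comap_le_sup_and` (`(N_p f)(t) ⟺ (L)_t(p) ∧ [invariants of degree 2p algebraic on X_t]`).
* §2 **`algebraicInvariantClassesAt_iff_exists_lerayIdempotentC`** — `(N_p f)(t)` ⟺ [∃ algebraic Leray idempotent at `(t, 2p)` with algebraic
  image] (`p + q = d`; part XXVIII-c, no side condition).
* §3 **`algebraicInvariantClassesAt_compl_of_le` — BELOW THE MIDDLE (N_p) PROPAGATES: `2p ≤ d`, `p + q = d`: `(N_p f)(t) ⟹ (N_q f)(t)`** (the
  invariants of degree `2q` are `L_κ^{q−p}` of those of degree `2p` — hard Lefschetz on the invariants, part XXVIII-c — and `L_K^{q−p}` carries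
  algebraic lifts to algebraic lifts). Hence `forall_algebraicInvariantClassesAt_iff_forall_le_half` (the algebraic fixed part of the pencil is
  decided in the degrees `2p ≤ d`), **`fibreClassLefschetz_deg_pair_of_algebraicInvariantClassesAt_of_le`** ((N_p) alone, `2p ≤ d`, gives BOTH
  clauses `p` and `q` of (β′_f), part XIV-e by name), `fibreClassLefschetzOn_of_algebraicInvariantClassesAt_le_half` ((β′_f) ⟸ `⋀_{2p ≤ d} (N_p)`),
  and `exists_lerayIdempotentC_pair_of_algebraicInvariantClassesAt_of_le` (idempotents with algebraic image in degrees `2p` AND `2q` from (N_p) alone).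

## Honest status

No node is born (`AlgebraicInvariantClassesAt` is part XIV-f's existing parameterised predicate, not a census node); nothing is minimal; nothing
here is fact-free progress on `HC_AV`. `(N_p f)(t)` is NOT on-path in general (constant CM factor: transcendental invariants); under the clause
"invariants of degree `2p` algebraic on `X_t`" it is (L)_t(p) (§1), on-path modulo Verdier (part XX).

References: Abdulali1994FamiliesAV (Conj. 5.3, Thm. 5.5); Milne2020HodgeClassesAV (proof of Prop. 1); DeningerMurre1991 (Thm. 3.1); VoisinHodgeI2002
(Thm. 6.25); Lieberman1968; Fulton1998 (Cor. 19.2 (b)); Andre1996Motifs (§5.1, Remarque 2).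
-/

noncomputable section

set_option linter.dupNamespace false

namespace Summit.HodgeConjecture.HodgeConjecture.Ring2.AbelianAll

open CategoryTheory AlgebraicGeometry
open Literature.AlgebraicGeometry Literature.AlgebraicGeometry.Motives
open Literature.AlgebraicGeometry.HodgeTheory

variable {𝒳 S : SchemeOver ℂ} {d : ℕ} {f : 𝒳 ⟶ S}

/-! ## §1 The predicate (N_p f)(t) in the three spellings of part XXVIII -/

/-- `(N_p f)(t) ⟺ j_t^* H^{2p}(𝒳) ⊆ j_t^* Nᵖ(𝒳)` (unfolding). [cite: Abdulali1994FamiliesAV, Theorem 5.5 (p. 1130)] -/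
theorem algebraicInvariantClassesAt_iff_range_le_map (hf : IsCompactAbelianPencil f d) (t : ComplexPoints S) (p : ℕ) :
    AlgebraicInvariantClassesAt hf t p ↔
      LinearMap.range (complexBetti.map (fiberι f t) (2 * p)).hom ≤
        (algebraicClasses 𝒳 p).map (complexBetti.map (fiberι f t) (2 * p)).hom := by
  refine ⟨fun h ↦ ?_, fun h W ↦ ?_⟩
  · rintro _ ⟨W, rfl⟩
    obtain ⟨D, hD, hDW⟩ := h W
    exact Submodule.mem_map.2 ⟨D, hD, hDW⟩
  · obtain ⟨D, hD, hDW⟩ := Submodule.mem_map.1 (h (LinearMap.mem_range_self _ W))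
    exact ⟨D, hD, hDW⟩

/-- **`(N_p f)(t) ⟺ Nᵖ(𝒳) ⊔ ker j_t^* = H^{2p}(𝒳)`** (every class of the total space is algebraic modulo the classes dying on `X_t`).
[cite: Milne2020HodgeClassesAV, proof of Prop. 1 (p. 7)] -/
theorem algebraicInvariantClassesAt_iff_sup_ker_eq_top (hf : IsCompactAbelianPencil f d) (t : ComplexPoints S) (p : ℕ) :
    AlgebraicInvariantClassesAt hf t p ↔
      algebraicClasses 𝒳 p ⊔ LinearMap.ker (complexBetti.map (fiberι f t) (2 * p)).hom = ⊤ :=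
  (algebraicInvariantClassesAt_iff_range_le_map hf t p).trans (sup_ker_eq_top_iff_range_le_map t).symm

/-- **`(N_p f)(t) ⟺ (L)_t(p) ∧ [the invariant classes of degree 2p are algebraic on X_t]`** (⟸ part XXI; ⟹ Fulton's pull-back theorem, part
XXVIII-c). [cite: Milne2020HodgeClassesAV, Prop. 1 (p. 7)] [cite: Fulton1998, §19.2 Cor. 19.2 (b)] -/
theorem algebraicInvariantClassesAt_iff_comap_le_sup_and (hf : IsCompactAbelianPencil f d) (t : ComplexPoints S) (p : ℕ) :
    AlgebraicInvariantClassesAt hf t p ↔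
      ((algebraicClasses (fiberOver f t) p).comap (complexBetti.map (fiberι f t) (2 * p)).hom ≤
          algebraicClasses 𝒳 p ⊔ LinearMap.ker (complexBetti.map (fiberι f t) (2 * p)).hom ∧
        LinearMap.range (complexBetti.map (fiberι f t) (2 * p)).hom ≤ algebraicClasses (fiberOver f t) p) :=
  (algebraicInvariantClassesAt_iff_range_le_map hf t p).trans (comap_le_sup_and_range_le_iff_range_le_map hf t).symm

/-! ## §2 (N_p f)(t) IS the idempotent package at `(t, 2p)` -/

/-- **`(N_p f)(t)` ⟺ [there is an endomorphism of `H^{2p}(𝒳(ℂ); ℂ)` induced by an algebraic cycle on `𝒳 × 𝒳` with `j_t^* e = j_t^*`,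
`e|ker j_t^* = 0`, and image inside `Nᵖ(𝒳)`]**, for every compact pencil of abelian `d`-folds, every point `t` and every `p + q = d` — NO side
condition (part XXVIII-c `range_le_map_iff_exists_lerayIdempotentC'`, by name). The two find-the-cycle tasks of the André axis at `(t, p)` —
the Leray idempotent and the algebraic lifts of the invariant classes — are ONE task. [cite: Milne2020HodgeClassesAV, proof of Prop. 1 (pp. 7–8)]
[cite: DeningerMurre1991, Thm. 3.1 and Cor. 3.2] [cite: Abdulali1994FamiliesAV, Theorem 5.5 (p. 1130)] -/
theorem algebraicInvariantClassesAt_iff_exists_lerayIdempotentC (hf : IsCompactAbelianPencil f d) (t : ComplexPoints S) {p q : ℕ}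
    (hpq : p + q = d) :
    AlgebraicInvariantClassesAt hf t p ↔
      ∃ e : complexBetti 𝒳 (2 * p) →ₗ[ℂ] complexBetti 𝒳 (2 * p),
        IsAlgebraicCorrespondence (d + 1) (d + 1) 𝒳 𝒳 e ∧
        (∀ w, complexBetti.map (fiberι f t) (2 * p) (e w) = complexBetti.map (fiberι f t) (2 * p) w) ∧
        (∀ w, complexBetti.map (fiberι f t) (2 * p) w = 0 → e w = 0) ∧
        (∀ w, e w ∈ algebraicClasses 𝒳 p) :=
  (algebraicInvariantClassesAt_iff_range_le_map hf t p).trans (range_le_map_iff_exists_lerayIdempotentC' hf t hpq)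

/-! ## §3 Below the middle (N_p) propagates to the complementary degree -/

/-- **`(N_p f)(t) ⟹ (N_q f)(t)` for `2p ≤ d`, `p + q = d`.** Every invariant class of degree `2q` is `L_κ^{q−p} j_t^* x` for an invariant
`j_t^* x` of degree `2p` (hard Lefschetz maps the invariants ONTO the invariants, part XXVIII-c `map_range_lefschetzPowTo_eq_range`, with `K` the
global algebraic polarisation of part XXI-a and `κ = j_t^* K`); if `j_t^* x = j_t^* D` with `D ∈ Nᵖ(𝒳)`, then it is `j_t^*(L_K^{q−p} D)` with
`L_K^{q−p} D ∈ N^q(𝒳)`. [cite: VoisinHodgeI2002, §6.2.3 Thm. 6.25] [cite: VoisinHodgeII2003, §9.2.4 Prop. 9.20] [cite: DeligneHodgeII1971, Thm. 4.1.1] -/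
theorem algebraicInvariantClassesAt_compl_of_le (hf : IsCompactAbelianPencil f d) (t : ComplexPoints S) {p q : ℕ} (hpq : p + q = d)
    (hle : p ≤ q) (h : AlgebraicInvariantClassesAt hf t p) : AlgebraicInvariantClassesAt hf t q := by
  have h𝒳 := hf.isSmoothProjective_total
  obtain ⟨K, hKalg, -, hKs⟩ := exists_algebraic_globalPolarization hf
  rw [algebraicInvariantClassesAt_iff_range_le_map] at h ⊢
  have hm : 2 * p + 2 * (q - p) = 2 * q := by omega
  have hl : p + (q - p) = q := by omega
  have hpr : 2 * p + (q - p) = d := by omega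
  rw [← map_range_lefschetzPowTo_eq_range hf.isSmoothProjective_base hf.isSmoothProjectiveFamily h𝒳 t K (hKs t).hasHardLefschetz
    (p := p) (q := q) (r := q - p) hpr hl]
  rintro _ ⟨a, ha, rfl⟩
  obtain ⟨D, hD, hDa⟩ := Submodule.mem_map.1 (h ha)
  have hDalg : lefschetzPowTo K (q - p) (2 * p) (2 * q) hm D ∈ algebraicClasses 𝒳 q :=
    lefschetzPowTo_mem_algebraicClasses h𝒳 hKalg hD (q - p) q hl hm
  refine Submodule.mem_map.2 ⟨lefschetzPowTo K (q - p) (2 * p) (2 * q) hm D, hDalg, ?_⟩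
  change complexBetti.map (fiberι f t) (2 * q) (lefschetzPowTo K (q - p) (2 * p) (2 * q) hm D) = _
  rw [map_fiberι_lefschetzPowTo t K (q - p) (2 * p) (2 * q) hm D]
  change lefschetzPowTo _ (q - p) (2 * p) (2 * q) hm ((complexBetti.map (fiberι f t) (2 * p)).hom D) = _
  rw [hDa]

/-- **The algebraic fixed part of a compact abelian pencil is decided in the degrees `2p ≤ d`**: `(N_p f)(t)` for all `p ≤ d` ⟺ `(N_p f)(t)` for
all `p` with `2p ≤ d`. [cite: VoisinHodgeI2002, §6.2.3 Thm. 6.25] [cite: Abdulali1994FamiliesAV, Theorem 5.5 (p. 1130)] -/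
theorem forall_algebraicInvariantClassesAt_iff_forall_le_half (hf : IsCompactAbelianPencil f d) (t : ComplexPoints S) :
    (∀ p ≤ d, AlgebraicInvariantClassesAt hf t p) ↔ ∀ p, 2 * p ≤ d → AlgebraicInvariantClassesAt hf t p := by
  refine ⟨fun h p hp ↦ h p (by omega), fun h p hp ↦ ?_⟩
  rcases le_or_gt (2 * p) d with h2 | h2
  · exact h p h2
  · exact algebraicInvariantClassesAt_compl_of_le hf t (p := d - p) (q := p) (by omega) (by omega) (h (d - p) (by omega))

/-- **BOTH clauses `p` and `q = d − p` of the fibre-class Lefschetz node (β′_f) from `(N_p f)(t)` alone, `2p ≤ d`** (part XIV-e's explicit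
cycles `∑ Dᵢ × Aᵢ`, by name, fed with §3). [cite: Abdulali1994FamiliesAV, Conjecture 5.3 and Theorem 5.5 (p. 1130)] -/
theorem fibreClassLefschetz_deg_pair_of_algebraicInvariantClassesAt_of_le (hf : IsCompactAbelianPencil f d) (t : ComplexPoints S)
    {p q : ℕ} (hpq : p + q = d) (hle : p ≤ q) (h : AlgebraicInvariantClassesAt hf t p) :
    (∃ T : complexBetti 𝒳 (2 * (p + 1)) →ₗ[ℂ] complexBetti 𝒳 (2 * p),
      IsAlgebraicCorrespondence (d + 1) (d + 1) 𝒳 𝒳 T ∧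
        ∀ (W : complexBetti 𝒳 (2 * p)) (t' s : ComplexPoints S),
          complexBetti.map (fiberι f s) (2 * p) (T (fiberGysin hf t' p (complexBetti.map (fiberι f t') (2 * p) W))) =
            complexBetti.map (fiberι f s) (2 * p) W) ∧
    (∃ T : complexBetti 𝒳 (2 * (q + 1)) →ₗ[ℂ] complexBetti 𝒳 (2 * q),
      IsAlgebraicCorrespondence (d + 1) (d + 1) 𝒳 𝒳 T ∧
        ∀ (W : complexBetti 𝒳 (2 * q)) (t' s : ComplexPoints S),
          complexBetti.map (fiberι f s) (2 * q) (T (fiberGysin hf t' q (complexBetti.map (fiberι f t') (2 * q) W))) =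
            complexBetti.map (fiberι f s) (2 * q) W) :=
  have hq := algebraicInvariantClassesAt_compl_of_le hf t hpq hle h
  ⟨fibreClassLefschetz_deg_of_algebraicInvariantClassesAt hf hpq t h hq,
    fibreClassLefschetz_deg_of_algebraicInvariantClassesAt hf (show q + p = d by omega) t hq h⟩

/-- **(β′_f) ⟸ `⋀_{2p ≤ d} (N_p f)(t)`** (part XIV-f's `fibreClassLefschetzOn_of_algebraicInvariantClassesAt` needed all `p ≤ d`).
[cite: Abdulali1994FamiliesAV, Conjecture 5.3 (p. 1130)] [cite: Andre1996Motifs, Remarque 2 (p. 33)] -/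
theorem fibreClassLefschetzOn_of_algebraicInvariantClassesAt_le_half (hf : IsCompactAbelianPencil f d) (t : ComplexPoints S)
    (h : ∀ p, 2 * p ≤ d → AlgebraicInvariantClassesAt hf t p) : FibreClassLefschetzOn hf :=
  fibreClassLefschetzOn_of_algebraicInvariantClassesAt hf t ((forall_algebraicInvariantClassesAt_iff_forall_le_half hf t).2 h)

/-- **Algebraic Leray idempotents with algebraic image in BOTH degrees `2p` and `2q = 2d − 2p` from `(N_p f)(t)` alone, `2p ≤ d`.**
[cite: Milne2020HodgeClassesAV, proof of Prop. 1 (pp. 7–8)] [cite: DeningerMurre1991, Thm. 3.1 and Cor. 3.2] -/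
theorem exists_lerayIdempotentC_pair_of_algebraicInvariantClassesAt_of_le (hf : IsCompactAbelianPencil f d) (t : ComplexPoints S)
    {p q : ℕ} (hpq : p + q = d) (hle : p ≤ q) (h : AlgebraicInvariantClassesAt hf t p) :
    (∃ e : complexBetti 𝒳 (2 * p) →ₗ[ℂ] complexBetti 𝒳 (2 * p),
        IsAlgebraicCorrespondence (d + 1) (d + 1) 𝒳 𝒳 e ∧
        (∀ w, complexBetti.map (fiberι f t) (2 * p) (e w) = complexBetti.map (fiberι f t) (2 * p) w) ∧
        (∀ w, complexBetti.map (fiberι f t) (2 * p) w = 0 → e w = 0) ∧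
        (∀ w, e w ∈ algebraicClasses 𝒳 p)) ∧
    (∃ e : complexBetti 𝒳 (2 * q) →ₗ[ℂ] complexBetti 𝒳 (2 * q),
        IsAlgebraicCorrespondence (d + 1) (d + 1) 𝒳 𝒳 e ∧
        (∀ w, complexBetti.map (fiberι f t) (2 * q) (e w) = complexBetti.map (fiberι f t) (2 * q) w) ∧
        (∀ w, complexBetti.map (fiberι f t) (2 * q) w = 0 → e w = 0) ∧
        (∀ w, e w ∈ algebraicClasses 𝒳 q)) :=
  ⟨(algebraicInvariantClassesAt_iff_exists_lerayIdempotentC hf t hpq).1 h,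
    (algebraicInvariantClassesAt_iff_exists_lerayIdempotentC hf t (show q + p = d by omega)).1
      (algebraicInvariantClassesAt_compl_of_le hf t hpq hle h)⟩

/-- **Point-free**: the idempotent package at `(t, 2p)` exists iff it exists at `(s, 2p)` (`(N_p f)` does not depend on the point, part XIV-f).
[cite: DeligneHodgeII1971, Thm. 4.1.1] [cite: Andre1996Motifs, §5.1 (p. 25)] -/
theorem exists_lerayIdempotentC_iff_of_points (hf : IsCompactAbelianPencil f d) (t s : ComplexPoints S) {p q : ℕ} (hpq : p + q = d) :
    (∃ e : complexBetti 𝒳 (2 * p) →ₗ[ℂ] complexBetti 𝒳 (2 * p),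
        IsAlgebraicCorrespondence (d + 1) (d + 1) 𝒳 𝒳 e ∧
        (∀ w, complexBetti.map (fiberι f t) (2 * p) (e w) = complexBetti.map (fiberι f t) (2 * p) w) ∧
        (∀ w, complexBetti.map (fiberι f t) (2 * p) w = 0 → e w = 0) ∧
        (∀ w, e w ∈ algebraicClasses 𝒳 p)) ↔
    (∃ e : complexBetti 𝒳 (2 * p) →ₗ[ℂ] complexBetti 𝒳 (2 * p),
        IsAlgebraicCorrespondence (d + 1) (d + 1) 𝒳 𝒳 e ∧
        (∀ w, complexBetti.map (fiberι f s) (2 * p) (e w) = complexBetti.map (fiberι f s) (2 * p) w) ∧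
        (∀ w, complexBetti.map (fiberι f s) (2 * p) w = 0 → e w = 0) ∧
        (∀ w, e w ∈ algebraicClasses 𝒳 p)) := by
  rw [← algebraicInvariantClassesAt_iff_exists_lerayIdempotentC hf t hpq, ← algebraicInvariantClassesAt_iff_exists_lerayIdempotentC hf s hpq]
  exact ⟨fun h ↦ algebraicInvariantClassesAt_of_at hf h s, fun h ↦ algebraicInvariantClassesAt_of_at hf h t⟩

end Summit.HodgeConjecture.HodgeConjecture.Ring2.AbelianAll

end
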